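import Mathlib
import Summits.KontsevichZagierPeriods.Zeta5Search.ClassTypeGuardsO
import Summits.KontsevichZagierPeriods.Zeta5Search.ClassTypeGuardsI
import Summits.KontsevichZagierPeriods.Zeta5Search.RayC1Levels
import HarnessLib

/-!
# ζ(5) search — CLASS TYPE COVERS on the T1-map ray C1: the collinearity rung (letter O) and law A3 (letter I) wrappers (fam-denom g13)

HONEST FRAMING: systematic search; no irrationality claim unless certified.  Cell `pub-zeta5`, family-designer seat
fam-denom (denominator arithmetic), generation 13.  p3 g6's record-ray wrappers `ClassTypeGuardsO.record_O` (census letter O: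
the collinearity rung `rungO_of_cover`, `casLB + 1` under `checkO`, `N ≥ 3` odd, moment range) and `ClassTypeGuardsI.record_I`
(letter I: the second-order law A3 `lawA3_of_cover`, `6 − 2M` under `checkI`, `M ≥ 6` even) RE-INSTANTIATED, verbatim in shape, on the
T1-map ray C1 = g8 #1, `bRay β1 n = n·(85; 35,32,30,27,25,22,20)` (`T1Rays.β1`, `d = 64n`), over P1 g13's generic layer `RayC1Levels`
(`oddFlag_ray1`, `ray1_window`, `ray1_LBthm`): `ray1_O` (moment range `(N − 1)·p ≤ 128·n + 1`, i.e. `((N − 1)p + 2 ≤ 2·dOf + 3` with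
`dOf = 64n`) and `ray1_I`.  Consumers: the machine-generated ray-C1 LETTERS window files (`RayC1Letters*`, P1 g13's port of p3 g6's
generator) on the census O windows (67 windows of `KERNEL-LEDGER-C1` §4) and on the 217 `P1B1I1` windows (third digit, same face files),
for the ray-C1 kernel atlas (`RayKernel.cell_cert`, typer g17).  Valuations of rationals; every kernel exponent these feed stays `< 1` —
no irrationality content.
-/

open Finset

namespace Summit.KontsevichZagierPeriods.Zeta5Search.ClassTypeCover

open Summit.KontsevichZagierPeriods.Zeta5Search.ClusterValuation
open Summit.KontsevichZagierPeriods.Zeta5Search.CasoratianValuation (InPolytope shift casoratian)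
open Summit.KontsevichZagierPeriods.Zeta5Search.WedgeDictionary (dOf)
open Summit.KontsevichZagierPeriods.Zeta5Search.T1Rays (bRay β1 inPolytope_ray1 inPolytope_shift_ray1 dOf_ray1)

variable {p : ℕ}

/-! ## §1 Letter O on the ray C1 -/

/-- **RAY-C1 WINDOW BOUND by the COLLINEARITY RUNG**: `c ≤ v_p(Cas₇(bRay β1 n))` from a cover, `checkLB` at `(−N, B)` with
`c ≤ −N + B + 1`, `checkO` at `N` (`N ≥ 3` odd, moment range `(N − 1)p ≤ 128n + 1`), and the fallback `checkLBx`. -/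
theorem ray1_O {n : ℕ} (hn : 1 ≤ n) (hpr : p.Prime) (hp5 : 5 ≤ p) (hpd : p ≤ 64 * n) (hsq : 85 * n + 2 < p ^ 2)
    {r : ℕ} (hr : n % 2 = r) {TY : List (List ℤ × Bool)} (hcov : Cover (bRay β1 n) p TY) {N : ℕ} (hN : 3 ≤ N)
    (hodd : N % 2 = 1) (hrange : (N - 1) * p ≤ 128 * n + 1) {K₁ K₂ : Bool × List ℤ} {B A' B' c : ℤ}
    (hLB : checkLB (decide (r = 1)) TY (-(N : ℤ)) B = true) (hB1 : B ≤ 1)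
    (hO : checkO (decide (r = 1)) TY N K₁ K₂ = true)
    (hLBx : checkLBx (decide (r = 1)) TY (-(N : ℤ)) A' B' = true) (hB1' : B' ≤ 1)
    (hc : c ≤ -(N : ℤ) + B + 1) (hc' : c ≤ A' + B') (hc0 : c ≤ 0)
    (hne : casoratian (bRay β1 n) 7 ≠ 0) : c ≤ padicValRat p (casoratian (bRay β1 n) 7) := by
  haveI : Fact p.Prime := ⟨hpr⟩
  obtain ⟨hpb, hpd', hwin⟩ := ray1_window (n := n) hpd hsq
  have hv := ray1_LBthm hn hpr hp5 hpd hsq hne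
  have hrange' : ((N : ℤ) - 1) * p + 2 ≤ 2 * dOf (bRay β1 n) + 3 := by
    rw [dOf_ray1]
    have h1 : 1 ≤ N := by omega
    have : (((N - 1 : ℕ) : ℤ)) = (N : ℤ) - 1 := by omega
    have h2 : (((N - 1) * p : ℕ) : ℤ) ≤ 128 * n + 1 := by exact_mod_cast hrange
    push_cast at h2
    nlinarith
  by_cases hreal : ∃ x, x < p ∧ 2 ≤ classPoleCount (bRay β1 n) p x ∧ classExp (bRay β1 n) p x = -(N : ℤ)
  · have hO' := rungO_of_cover (inPolytope_ray1 n) (by norm_num) (by norm_num) (inPolytope_shift_ray1 hn) hpr hp5 hpb hpd' hwin hcov hN hodd hrange' (by rw [oddFlag_ray1 n hr]; exact hO) hreal hne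
    rcases casLB_ge_of_cover hcov (by rw [oddFlag_ray1 n hr]; exact hLB) hB1 hpd' with h0 | h
    · rw [h0] at hv; exact le_trans (by exact_mod_cast hc0) hv
    · linarith
  · rcases casLB_ge_of_cover_x hcov (by rw [oddFlag_ray1 n hr]; exact hLBx) hB1' hpd' hreal with h0 | h
    · rw [h0] at hv; exact le_trans (by exact_mod_cast hc0) hv
    · linarith

/-! ## §2 Letter I on the ray C1 -/

/-- **RAY-C1 WINDOW BOUND by LAW A3**: `c ≤ v_p(Cas₇(bRay β1 n))` from a cover and `checkI` (`M ≥ 6` even, `T` palindromic, `c ≤ 6 − 2M`). -/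
theorem ray1_I {n : ℕ} (hn : 1 ≤ n) (hpr : p.Prime) (hp5 : 5 ≤ p) (hpd : p ≤ 64 * n) (hsq : 85 * n + 2 < p ^ 2)
    {r : ℕ} (hr : n % 2 = r) {TY : List (List ℤ × Bool)} (hcov : Cover (bRay β1 n) p TY) {M : ℕ} (hM : 6 ≤ M) (hMe : Even M)
    {T : List ℤ} (hT : T.reverse = T) (hI : checkI (decide (r = 1)) TY M T = true) {c : ℤ} (hc : c ≤ 6 - 2 * M)
    (hne : casoratian (bRay β1 n) 7 ≠ 0) : c ≤ padicValRat p (casoratian (bRay β1 n) 7) := by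
  obtain ⟨hpb, -, hwin⟩ := ray1_window (n := n) hpd hsq
  have h := lawA3_of_cover (inPolytope_ray1 n) (inPolytope_shift_ray1 hn) (by norm_num)
    (by norm_num) hpr hp5 hpb hwin hcov hM hMe hT (by rw [oddFlag_ray1 n hr]; exact hI) hne
  linarith

end Summit.KontsevichZagierPeriods.Zeta5Search.ClassTypeCover
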